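import Summits.CriticalPhenomena.PercolationContinuityZ3.Theorems.PercNearOneGluingNoHeavyQuantSDEC
import HarnessLib

/-!
# QUANT lane R8 on trees: Theorem A (two-layer closure at `q = 1`, `y ≥ 1/2`) — part 2a, the EXPLICIT ROW DATA of the certificate S*
# and its properties (H1)–(H4), (H6) required by `halfCert_pointwise` (`…QuantTwoLayerHalfPointwise`)

builds on p205010 (kernel theorem, internal audit signed; external expert review pending)

Support file (`--supports stmt-CriticalPhenomena-4575`), QUANT lane seat prim-quant-arm-2 (gen 38), rung R8 of
`run/shared/lean/prim/quant/LADDER.md`; memo `run/shared/lean/prim/quant/prim-quant-arm-2-g38/TWO-LAYER-CLOSURE-G38.md` §7, §11.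
Theorems only, standard axioms, no sorries.

THE ROW DATA (memo §7).  Lower layer `k`, thresholds `t₁`, `t₂` (`2k < t₁ + t₂`).  Row `s` is ACTIVE iff `s ≤ k ∧ k < t₁ + s ∧ 0 < t₁`, with threshold
`c s = min (k − s) (min (⌈t₁/2⌉₊ − 1) (⌈t₁ − k + s⌉₊ − 1))` (factor 1's reflection at `c s`: `−u` on `a ≤ c s`, `+1` on `a ≥ t₁ − c s`).  This file proves,
for these explicit expressions: (H1) `2·c s < t₁` (validity), (H2) `c s + s ≤ k`, (H3) `c s < t₁ − k + s` (the `+` region avoids low cells), (H4) an uncovered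
low cell `(a, s)` has `t₁ ≤ 2a` or `t₁ − k + s ≤ a`, (H6) every low cell of a HIGH row (`t₂ ≤ 2s`) is covered (so U- and W-cells live in low rows and the
column reflections they trigger are valid).

* `LawDec.halfRows_H1`, `halfRows_H2`, `halfRows_H3`, `halfRows_H4`, `halfRows_H6`.

[this work].  Nothing here is cited as a published result.  The gluing rows served [cite: KozmaNitzan2024, Conjecture 3 (p. 15)]; product measure
[cite: Grimmett1999, §1.3 p. 10].
-/

noncomputable section

namespace Summit.CriticalPhenomena.PercolationContinuityZ3.Theorems

namespace Quant

open Finset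

namespace LawDec

/-- `⌈x⌉₊ − 1 < x` for `0 < x` (as reals, with the truncated subtraction harmless since `⌈x⌉₊ ≥ 1`). [this work] -/
theorem cast_ceil_sub_one_lt {x : ℝ} (hx : 0 < x) : ((⌈x⌉₊ - 1 : ℕ) : ℝ) < x := by
  have h1 : 1 ≤ ⌈x⌉₊ := Nat.one_le_iff_ne_zero.2 (Nat.pos_iff_ne_zero.1 (Nat.ceil_pos.2 hx))
  rw [Nat.cast_sub h1, Nat.cast_one]
  have := Nat.ceil_lt_add_one hx.le
  linarith

/-- **(H1) validity**: on an active row, `2·c s < t₁`. [this work] -/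
theorem halfRows_H1 (t₁ : ℝ) (k s : ℕ) (ht : 0 < t₁) :
    2 * ((min (k - s) (min (⌈t₁ / 2⌉₊ - 1) (⌈t₁ - k + s⌉₊ - 1)) : ℕ) : ℝ) < t₁ := by
  have hle : min (k - s) (min (⌈t₁ / 2⌉₊ - 1) (⌈t₁ - k + s⌉₊ - 1)) ≤ ⌈t₁ / 2⌉₊ - 1 :=
    le_trans (Nat.min_le_right _ _) (Nat.min_le_left _ _)
  have hcast : ((min (k - s) (min (⌈t₁ / 2⌉₊ - 1) (⌈t₁ - k + s⌉₊ - 1)) : ℕ) : ℝ) ≤ ((⌈t₁ / 2⌉₊ - 1 : ℕ) : ℝ) := by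
    exact_mod_cast hle
  have := cast_ceil_sub_one_lt (by linarith : 0 < t₁ / 2)
  linarith

/-- **(H2)**: `c s + s ≤ k` for `s ≤ k`. [this work] -/
theorem halfRows_H2 (t₁ : ℝ) (k s : ℕ) (hs : s ≤ k) :
    min (k - s) (min (⌈t₁ / 2⌉₊ - 1) (⌈t₁ - k + s⌉₊ - 1)) + s ≤ k := by
  have := Nat.min_le_left (k - s) (min (⌈t₁ / 2⌉₊ - 1) (⌈t₁ - k + s⌉₊ - 1))
  omega

/-- **(H3)**: on an active row, `c s < t₁ − k + s`. [this work] -/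
theorem halfRows_H3 (t₁ : ℝ) (k s : ℕ) (hks : (k : ℝ) < t₁ + s) :
    ((min (k - s) (min (⌈t₁ / 2⌉₊ - 1) (⌈t₁ - k + s⌉₊ - 1)) : ℕ) : ℝ) < t₁ - k + s := by
  have hle : min (k - s) (min (⌈t₁ / 2⌉₊ - 1) (⌈t₁ - k + s⌉₊ - 1)) ≤ ⌈t₁ - k + s⌉₊ - 1 :=
    le_trans (Nat.min_le_right _ _) (Nat.min_le_right _ _)
  have hcast : ((min (k - s) (min (⌈t₁ / 2⌉₊ - 1) (⌈t₁ - k + s⌉₊ - 1)) : ℕ) : ℝ) ≤ ((⌈t₁ - k + s⌉₊ - 1 : ℕ) : ℝ) := by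
    exact_mod_cast hle
  have := cast_ceil_sub_one_lt (by linarith : 0 < t₁ - k + s)
  linarith

/-- **(H4) uncovered low cells**: if `a + s ≤ k` and the cell is not covered by its row (the row is inactive, or `c s < a`), then `t₁ ≤ 2a` or
`t₁ − k + s ≤ a`. [this work] -/
theorem halfRows_H4 (t₁ : ℝ) (k a s : ℕ) (hlow : a + s ≤ k)
    (hunc : ¬ (s ≤ k ∧ (k : ℝ) < t₁ + s ∧ 0 < t₁) ∨ min (k - s) (min (⌈t₁ / 2⌉₊ - 1) (⌈t₁ - k + s⌉₊ - 1)) < a) :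
    t₁ ≤ 2 * (a : ℝ) ∨ t₁ - k + s ≤ (a : ℝ) := by
  have ha0 : (0 : ℝ) ≤ a := Nat.cast_nonneg a
  by_cases ht : 0 < t₁
  · by_cases hks : (k : ℝ) < t₁ + s
    · -- the row is active: the uncovered cell lies beyond `c s`, which is not `k − s`
      rcases hunc with hna | hlt
      · exact (hna ⟨by omega, hks, ht⟩).elim
      · rcases min_lt_iff.1 hlt with h1 | h23
        · exfalso; omega
        · rcases min_lt_iff.1 h23 with h2 | h3
          · left
            have hle : ⌈t₁ / 2⌉₊ ≤ a := by omega
            have := Nat.ceil_le.1 hle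
            linarith
          · right
            have hle : ⌈t₁ - k + s⌉₊ ≤ a := by omega
            exact Nat.ceil_le.1 hle
    · right; linarith
  · left; linarith

/-- **(H6) high rows are fully covered**: if `2k < t₁ + t₂`, `s ≤ k`, `t₂ ≤ 2s` and `a + s ≤ k`, then row `s` is active and `a ≤ c s`. [this work] -/
theorem halfRows_H6 (t₁ t₂ : ℝ) (k a s : ℕ) (hk : 2 * (k : ℝ) < t₁ + t₂) (hs : s ≤ k) (hhigh : t₂ ≤ 2 * (s : ℝ)) (hlow : a + s ≤ k) :
    (s ≤ k ∧ (k : ℝ) < t₁ + s ∧ 0 < t₁) ∧ a ≤ min (k - s) (min (⌈t₁ / 2⌉₊ - 1) (⌈t₁ - k + s⌉₊ - 1)) := by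
  have hsk : (s : ℝ) ≤ k := by exact_mod_cast hs
  have ht : 0 < t₁ := by linarith
  have hks : (k : ℝ) < t₁ + s := by linarith
  have has : (a : ℝ) + s ≤ k := by exact_mod_cast hlow
  refine ⟨⟨hs, hks, ht⟩, le_min (by omega) (le_min ?_ ?_)⟩
  · have hlt : (a : ℝ) < t₁ / 2 := by linarith
    have : a < ⌈t₁ / 2⌉₊ := Nat.lt_ceil.2 hlt
    omega
  · have hlt : (a : ℝ) < t₁ - k + s := by linarith
    have : a < ⌈t₁ - k + s⌉₊ := Nat.lt_ceil.2 hlt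
    omega

end LawDec

end Quant

end Summit.CriticalPhenomena.PercolationContinuityZ3.Theorems
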